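import Literature.IUT.HodgeTheaters.CoveringsErrata
import Mathlib.Topology.ClopenBox
import Mathlib.Analysis.Real.Cardinality
import Mathlib.Algebra.GroupWithZero.Units.Fintype
import HarnessLib

/-!
# [IUTchI] Remark 2.5.3 (ii) (E2): the universal closure of the typed predicate is FALSE (schema record)

Mochizuki, *Inter-universal Teichmüller theory I*, kurims manuscript (May 2020), Remark 2.5.3 (ii)
(E2), p. 53: "if `k` is a field whose absolute Galois group is Galois-countable, and `U` is … the
interior of a proper log smooth log scheme over `k` …, then the tamely ramified arithmetic fundamental
group of `U` … is itself Galois-countable [cf., e.g., [AbsTopI], Proposition 2.2]".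

abc-iut-L5-t6 typed this (model-relative) as the PREDICATE `Rmk253.TameGaloisCountable E` on an
ARBITRARY extension of profinite groups `E : FundamentalExtension` (`1 → Δ → Π → G → 1`,
abc-iut-L4-t1): "`G` second countable ⇒ `Π` second countable" (cell FACT-LIST row F-1979).  Print
asserts it only for the extensions ARISING from such `(k, X, U)`; the instance forms are PROVED in the
tree (`Rmk253.tameGaloisCountable_of_geomTFG`, `…_of_arith_tfg`, file `CoveringsErrataProofsE2.lean`:
whenever `Δ` — resp. `Π` — is topologically finitely generated, which [AbsTopI] Prop. 2.2 gives for
the geometric extensions).  This proof-only file records, by an explicit countermodel, that the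
UNIVERSAL CLOSURE over all `E` is false, so that the row is a schema and not an assumable fact:
`Π := ∏_{i ∈ ℝ} {±1}` (an uncountable product of copies of `ℤˣ`; compact, Hausdorff, totally
disconnected), `G := ∏_{pt} {±1}` (finite), augmentation = evaluation at one coordinate.  `G` is
second countable while `Π` is not: a compact Hausdorff totally disconnected second-countable space has
only countably many clopen subsets (Mathlib `TopologicalSpace.Clopens.countable_iff_secondCountable`),
whereas the coordinate conditions `{f | f i = 1}`, `i ∈ ℝ`, are pairwise distinct clopen subsets of `Π`.

Elementary topology; no definition, no new fact; nothing here takes a side on [IUTchIII] Cor. 3.12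
(the remark is an erratum to [SemiAnbd], outside the Cor. 3.12 cone).
-/

namespace Literature.IUT.HodgeTheaters

namespace Rmk253

universe u

open TopologicalSpace

/-- An uncountable product of copies of `{±1} = ℤˣ` is not second countable: the coordinate clopen
sets `{f | f i = 1}` are pairwise distinct, while a compact Hausdorff totally disconnected
second-countable space has countably many clopen sets. [cite: Mochizuki2012, IUTchI Rmk 2.5.3 (ii) (E2) p.53] -/
theorem not_secondCountableTopology_pi_units_int (ι : Type u) [Uncountable ι] :
    ¬ SecondCountableTopology (ι → ℤˣ) := by
  classical
  intro h
  have hc : Countable (Clopens (ι → ℤˣ)) := Clopens.countable_iff_secondCountable.mpr h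
  -- the coordinate clopens
  let φ : ι → Clopens (ι → ℤˣ) := fun i =>
    ⟨{f | f i = 1}, (isClopen_discrete ({1} : Set ℤˣ)).preimage (continuous_apply i)⟩
  have hφ : Function.Injective φ := by
    intro i j hij
    by_contra hne
    -- the function equal to `1` everywhere except `-1` at `j`
    let f : ι → ℤˣ := Function.update (fun _ => 1) j (-1)
    have hfi : f ∈ (φ i : Set (ι → ℤˣ)) := by
      show Function.update (fun _ => (1 : ℤˣ)) j (-1) i = 1
      rw [Function.update_of_ne hne]
    have hfj : f ∉ (φ j : Set (ι → ℤˣ)) := by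
      show ¬ Function.update (fun _ => (1 : ℤˣ)) j (-1) j = 1
      rw [Function.update_self]
      decide
    rw [hij] at hfi
    exact hfj hfi
  haveI : Countable ι := hφ.countable
  exact not_countable_iff.mpr ‹Uncountable ι› ‹Countable ι›

/-- **[IUTchI] Remark 2.5.3 (ii) (E2) as typed is a SCHEMA**: the universal closure of
`TameGaloisCountable` over ALL extensions of profinite groups `1 → Δ → Π → G → 1` is false.
Countermodel: `Π = ∏_{ℝ} {±1} ↠ G = ∏_{pt} {±1}` (evaluation at one coordinate); `G` is finite, `Π` is
not second countable.  (Print asserts (E2) only for extensions arising from log smooth `(k, X, U)`;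
those instance forms are `tameGaloisCountable_of_geomTFG` / `tameGaloisCountable_of_arith_tfg`.)
[cite: Mochizuki2012, IUTchI Rmk 2.5.3 (ii) (E2) p.53] -/
theorem not_forall_tameGaloisCountable :
    ¬ ∀ E : AnabelianGeometry.AbsoluteAnabelian.FundamentalExtension.{u}, TameGaloisCountable E := by
  intro h
  -- the countermodel
  let ι : Type u := ULift.{u} ℝ
  let P : Type u := ι → ℤˣ
  let Γ : Type u := PUnit.{u + 1} → ℤˣ
  let ev : P →* Γ := MonoidHom.pi fun _ => Pi.evalMonoidHom (fun _ : ι => ℤˣ) (ULift.up 0)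
  have hev : Continuous ev := by
    apply continuous_pi
    intro _
    exact continuous_apply _
  let aug : ProfiniteGrp.of P →ₜ* ProfiniteGrp.of Γ := ⟨ev, hev⟩
  have haug : Function.Surjective aug := by
    intro g
    refine ⟨fun _ => g PUnit.unit, ?_⟩
    funext x
    rfl
  let E : AnabelianGeometry.AbsoluteAnabelian.FundamentalExtension.{u} :=
    { arith := ProfiniteGrp.of P, gal := ProfiniteGrp.of Γ, aug := aug, aug_surjective := haug }
  have hG : SecondCountableTopology E.gal := by
    change SecondCountableTopology Γ
    infer_instance
  have hP : SecondCountableTopology P := h E hG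
  exact not_secondCountableTopology_pi_units_int ι hP

end Rmk253

end Literature.IUT.HodgeTheaters
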